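import Summits.ABC.IUTFork.Conditional.AbcOfSlotLicenceGenuineKZetaWild
import Summits.ABC.IUTFork.LDHGenuinePerImageShellRat
import HarnessLib

/-!
# Branch C, K line — the ζ-SHELL CUT of the Szpiro-bad (P)/joint certificates (junction grid A: `hNumJointZW ⟹ hNumJointZSh`): the per-image number-level Corollary demanded ONLY where OUR
# licences fail, the ζ30 sufficiency FAILS, no rational presentation passes the all-levers test, AND none passes abc-iut-c312-d1's log-shell test
abc-iut-C-cert-1 gen 7, row «C:SHELL-CUT» books (generator gencutshell.py). PROOF-ONLY (no `def`, no new `Prop`); DATA and binder texts VERBATIM from the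
ζ♯w parent `AbcOfSlotLicenceGenuineKZetaWild.lean`, ALL its antecedents KEPT and ONE ADDED: «¬ ∃ (q, I, e, N', D', Psh ⊆ I, a) presenting P = ratPoint q,
the shell poles p ∈ Psh with p ≠ 2, p ≠ l, l ∤ p − 1, satisfying the inequality of `Cor22.cor312PerImageOf_ratPoint_shell`» (p490291: DS weights
+ the wild log-shell term ((l+5)/4)·Σ_{p∈Psh}(a_p − p^{a_p}/m_p)·log p); on its complement `T.Cor312PerImageOf` is that KERNEL THEOREM (`l ≥ 7` by
`ThetaPartII.seven_le_of_condP6`). The shell test and the all-levers test are termwise INCOMPARABLE, so no monotonicity is claimed: the junction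
ζ♯w ⟹ ζ-shell is pure weakening and the books' chain stays total (ZSh ≤ ZW ≤ ZS ≤ Z30 ≤ Z ≤ Szpiro-bad parent, γ and joint, K and M). The 400-line cap
splits each line into four files (γ cert + γ junction · joint cert · joint→joint · γ→joint). READING (desk, abc-iut-c312-d1's scan, not kernel): every one of
the 2,158 tabulated N3 Szpiro-bad (triple, l) pairs (all 87 TARGET pairs) passes the shell test with margin ≥ 7.3 nats — on that scan the new rational antecedent
is never met; kernel instances are c312-d1's `LDHGenuinePerImageShellRows*`; NOTHING is said about untabulated data or d_mod ≥ 2. A cut twin is a weaker binder,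
NOT a discharge; explicit count stays 1; records untouched. Nothing here asserts that abc is proved or refuted, that [IUTchIII] Cor. 3.12 / [IUTchIV] Thm. 1.10 holds
or fails at any datum, or that Θ-data exist; no side on any author or on (U)/(P); typed ≠ proved. [claim: Mochizuki2012, status: disputed]
[cite: Mochizuki2012, IUTchI Def. 3.1 (a)(b)(c) p. 61–62; IUTchIII Cor. 3.12 p. 173–174, Step (x) p. 181, Step (xi-f) p. 184; IUTchIV Prop. 1.2 (i)(ii) p. 10, Thm. 1.10
p. 22–31, Step (ii) p. 24, Step (v) p. 27–29, Step (viii) p. 30] [cite: DupuyHilado2025, §4.9, §4.12] -/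
noncomputable section
open Set Function NumberField IsDedekindDomain
namespace Summit.ABC.IUTFork.Conditional
open Thm311 Thm311.Real Cor312 Cor312Vol Cor312Prov Literature.IUT.LogThetaLattice Literature.IUT.LogVolume
  Literature.IUT.HodgeTheaters Literature.IUT.LogVolume.ThetaData Literature.NumberTheory.NumberFields
open Literature.NumberTheory.DiophantineGeometry.GenEll Summit.ABC.ABC.Theorems
open scoped Classical
variable
    (M : ∀ (P : NFPoint) (l : ℕ) (T : Cor22.ThetaVolumeDatumAt P l), Type) [∀ P l T, Field (M P l T)] [∀ P l T, NumberField (M P l T)]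
    (archPk : ∀ (P : NFPoint) (l : ℕ) (T : Cor22.ThetaVolumeDatumAt P l), letI := T.instFieldF; letI := T.instNumberFieldF; letI := T.instAlgebraF; letI := T.instFieldK;
        letI := T.instNumberFieldK; letI := T.instAlgebraK; letI := T.instFieldFbar; letI := T.instAlgebraFbar;
        letI := T.instAlgebraKFbar; letI := T.instIsElliptic;
      ∀ (j : (thetaIndex (pilotDataOfK T.D T.K)).Label) (vQ : (thetaIndex (pilotDataOfK T.D T.K)).VQ), Set ((logShellsDH (pilotDataOfK T.D T.K) (analyticLogv T.K)).Packet j vQ))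
    (archSub : ∀ (P : NFPoint) (l : ℕ) (T : Cor22.ThetaVolumeDatumAt P l), letI := T.instFieldF; letI := T.instNumberFieldF; letI := T.instAlgebraF; letI := T.instFieldK;
        letI := T.instNumberFieldK; letI := T.instAlgebraK; letI := T.instFieldFbar; letI := T.instAlgebraFbar;
        letI := T.instAlgebraKFbar; letI := T.instIsElliptic;
      ∀ (j : (thetaIndex (pilotDataOfK T.D T.K)).Label) (v : (thetaIndex (pilotDataOfK T.D T.K)).V), Set ((logShellsDH (pilotDataOfK T.D T.K) (analyticLogv T.K)).Packet j ((thetaIndex (pilotDataOfK T.D T.K)).over v)))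
    (Ψ : ∀ (P : NFPoint) (l : ℕ) (T : Cor22.ThetaVolumeDatumAt P l), letI := T.instFieldF; letI := T.instNumberFieldF; letI := T.instAlgebraF; letI := T.instFieldK;
        letI := T.instNumberFieldK; letI := T.instAlgebraK; letI := T.instFieldFbar; letI := T.instAlgebraFbar;
        letI := T.instAlgebraKFbar; letI := T.instIsElliptic;
      ℤ → ∀ v : (thetaIndex (pilotDataOfK T.D T.K)).V, v ∈ (thetaIndex (pilotDataOfK T.D T.K)).Vbad → Set ((logShellsDH (pilotDataOfK T.D T.K) (analyticLogv T.K)).StarPacket v))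
    (act : ∀ (P : NFPoint) (l : ℕ) (T : Cor22.ThetaVolumeDatumAt P l), letI := T.instFieldF; letI := T.instNumberFieldF; letI := T.instAlgebraF; letI := T.instFieldK;
        letI := T.instNumberFieldK; letI := T.instAlgebraK; letI := T.instFieldFbar; letI := T.instAlgebraFbar;
        letI := T.instAlgebraKFbar; letI := T.instIsElliptic;
      ℤ → ∀ v : (thetaIndex (pilotDataOfK T.D T.K)).V, v ∈ (thetaIndex (pilotDataOfK T.D T.K)).Vbad → (logShellsDH (pilotDataOfK T.D T.K) (analyticLogv T.K)).StarPacket v → Module.End ℚ ((logShellsDH (pilotDataOfK T.D T.K) (analyticLogv T.K)).StarPacket v))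
    (Mmod : ∀ (P : NFPoint) (l : ℕ) (T : Cor22.ThetaVolumeDatumAt P l), letI := T.instFieldF; letI := T.instNumberFieldF; letI := T.instAlgebraF; letI := T.instFieldK;
        letI := T.instNumberFieldK; letI := T.instAlgebraK; letI := T.instFieldFbar; letI := T.instAlgebraFbar;
        letI := T.instAlgebraKFbar; letI := T.instIsElliptic;
      ℤ → ∀ j : (thetaIndex (pilotDataOfK T.D T.K)).LabelStar, Set ((logShellsDH (pilotDataOfK T.D T.K) (analyticLogv T.K)).GlobalPacket j.1))
    (region : ∀ (P : NFPoint) (l : ℕ) (T : Cor22.ThetaVolumeDatumAt P l), letI := T.instFieldF; letI := T.instNumberFieldF; letI := T.instAlgebraF; letI := T.instFieldK;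
        letI := T.instNumberFieldK; letI := T.instAlgebraK; letI := T.instFieldFbar; letI := T.instAlgebraFbar;
        letI := T.instAlgebraKFbar; letI := T.instIsElliptic;
      ℤ → ∀ j : (thetaIndex (pilotDataOfK T.D T.K)).LabelStar, FinDivisor (M P l T) → ∀ vQ : (thetaIndex (pilotDataOfK T.D T.K)).VQ, Set ((logShellsDH (pilotDataOfK T.D T.K) (analyticLogv T.K)).Packet j.1 vQ))
    (frobAdm : ∀ (P : NFPoint) (l : ℕ) (T : Cor22.ThetaVolumeDatumAt P l), letI := T.instFieldF; letI := T.instNumberFieldF; letI := T.instAlgebraF; letI := T.instFieldK;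
        letI := T.instNumberFieldK; letI := T.instAlgebraK; letI := T.instFieldFbar; letI := T.instAlgebraFbar;
        letI := T.instAlgebraKFbar; letI := T.instIsElliptic;
      ℤ → ℤ → ∀ (j : (thetaIndex (pilotDataOfK T.D T.K)).Label) (vQ : (thetaIndex (pilotDataOfK T.D T.K)).VQ), Set ((logShellsDH (pilotDataOfK T.D T.K) (analyticLogv T.K)).Packet j vQ) → Prop)
    (frobLogvol : ∀ (P : NFPoint) (l : ℕ) (T : Cor22.ThetaVolumeDatumAt P l), letI := T.instFieldF; letI := T.instNumberFieldF; letI := T.instAlgebraF; letI := T.instFieldK;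
        letI := T.instNumberFieldK; letI := T.instAlgebraK; letI := T.instFieldFbar; letI := T.instAlgebraFbar;
        letI := T.instAlgebraKFbar; letI := T.instIsElliptic;
      ℤ → ℤ → ∀ (j : (thetaIndex (pilotDataOfK T.D T.K)).Label) (vQ : (thetaIndex (pilotDataOfK T.D T.K)).VQ), Set ((logShellsDH (pilotDataOfK T.D T.K) (analyticLogv T.K)).Packet j vQ) → ℝ)
    (frobΨ : ∀ (P : NFPoint) (l : ℕ) (T : Cor22.ThetaVolumeDatumAt P l), letI := T.instFieldF; letI := T.instNumberFieldF; letI := T.instAlgebraF; letI := T.instFieldK;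
        letI := T.instNumberFieldK; letI := T.instAlgebraK; letI := T.instFieldFbar; letI := T.instAlgebraFbar;
        letI := T.instAlgebraKFbar; letI := T.instIsElliptic;
      ℤ → ℤ → ∀ v : (thetaIndex (pilotDataOfK T.D T.K)).V, v ∈ (thetaIndex (pilotDataOfK T.D T.K)).Vbad → Set ((logShellsDH (pilotDataOfK T.D T.K) (analyticLogv T.K)).StarPacket v))
    (frobMmod : ∀ (P : NFPoint) (l : ℕ) (T : Cor22.ThetaVolumeDatumAt P l), letI := T.instFieldF; letI := T.instNumberFieldF; letI := T.instAlgebraF; letI := T.instFieldK;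
        letI := T.instNumberFieldK; letI := T.instAlgebraK; letI := T.instFieldFbar; letI := T.instAlgebraFbar;
        letI := T.instAlgebraKFbar; letI := T.instIsElliptic;
      ℤ → ℤ → ∀ j : (thetaIndex (pilotDataOfK T.D T.K)).LabelStar, Set ((logShellsDH (pilotDataOfK T.D T.K) (analyticLogv T.K)).GlobalPacket j.1))
    (unitImage : ∀ (P : NFPoint) (l : ℕ) (T : Cor22.ThetaVolumeDatumAt P l), letI := T.instFieldF; letI := T.instNumberFieldF; letI := T.instAlgebraF; letI := T.instFieldK;
        letI := T.instNumberFieldK; letI := T.instAlgebraK; letI := T.instFieldFbar; letI := T.instAlgebraFbar;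
        letI := T.instAlgebraKFbar; letI := T.instIsElliptic;
      ℤ → ℤ → ℕ → ∀ (j : (thetaIndex (pilotDataOfK T.D T.K)).Label) (vQ : (thetaIndex (pilotDataOfK T.D T.K)).VQ), Set ((logShellsDH (pilotDataOfK T.D T.K) (analyticLogv T.K)).Packet j vQ))
    (ballImage : ∀ (P : NFPoint) (l : ℕ) (T : Cor22.ThetaVolumeDatumAt P l), letI := T.instFieldF; letI := T.instNumberFieldF; letI := T.instAlgebraF; letI := T.instFieldK;
        letI := T.instNumberFieldK; letI := T.instAlgebraK; letI := T.instFieldFbar; letI := T.instAlgebraFbar;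
        letI := T.instAlgebraKFbar; letI := T.instIsElliptic;
      ℤ → ℤ → ∀ (j : (thetaIndex (pilotDataOfK T.D T.K)).Label) (vQ : (thetaIndex (pilotDataOfK T.D T.K)).VQ), Set ((logShellsDH (pilotDataOfK T.D T.K) (analyticLogv T.K)).Packet j vQ))
    (thetaDiv : ∀ (P : NFPoint) (l : ℕ) (T : Cor22.ThetaVolumeDatumAt P l), letI := T.instFieldF; letI := T.instNumberFieldF; letI := T.instAlgebraF; letI := T.instFieldK;
        letI := T.instNumberFieldK; letI := T.instAlgebraK; letI := T.instFieldFbar; letI := T.instAlgebraFbar;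
        letI := T.instAlgebraKFbar; letI := T.instIsElliptic;
      ℤ → ℤ → LgpDivisor (M P l T) (thetaIndex (pilotDataOfK T.D T.K)).lstar)
    (n : ∀ (P : NFPoint) (l : ℕ) (T : Cor22.ThetaVolumeDatumAt P l), ℤ)
    {HT : ∀ (P : NFPoint) (l : ℕ) (T : Cor22.ThetaVolumeDatumAt P l), Type} {LogLink : ∀ (P : NFPoint) (l : ℕ) (T : Cor22.ThetaVolumeDatumAt P l), HT P l T → HT P l T → Type}
    {IsFull : ∀ (P : NFPoint) (l : ℕ) (T : Cor22.ThetaVolumeDatumAt P l), ∀ {s t : HT P l T}, LogLink P l T s t → Prop}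
    (lat : ∀ (P : NFPoint) (l : ℕ) (T : Cor22.ThetaVolumeDatumAt P l), LGPGaussianLogThetaLattice (LogLink P l T) (IsFull P l T))
    {Frd : ∀ (P : NFPoint) (l : ℕ) (T : Cor22.ThetaVolumeDatumAt P l), Type} {IsoF : ∀ (P : NFPoint) (l : ℕ) (T : Cor22.ThetaVolumeDatumAt P l), Frd P l T → Frd P l T → Type} {Ob : ∀ (P : NFPoint) (l : ℕ) (T : Cor22.ThetaVolumeDatumAt P l), Frd P l T → Type}
    {realify : ∀ (P : NFPoint) (l : ℕ) (T : Cor22.ThetaVolumeDatumAt P l), Frd P l T → Frd P l T} {Strip : ∀ (P : NFPoint) (l : ℕ) (T : Cor22.ThetaVolumeDatumAt P l), Type} {IsoS : ∀ (P : NFPoint) (l : ℕ) (T : Cor22.ThetaVolumeDatumAt P l), Strip P l T → Strip P l T → Type}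
    {Mv : ∀ (P : NFPoint) (l : ℕ) (T : Cor22.ThetaVolumeDatumAt P l), letI := T.instFieldF; letI := T.instNumberFieldF; letI := T.instAlgebraF; letI := T.instFieldK;
        letI := T.instNumberFieldK; letI := T.instAlgebraK; letI := T.instFieldFbar; letI := T.instAlgebraFbar;
        letI := T.instAlgebraKFbar; letI := T.instIsElliptic;
      ∀ v : (thetaIndex (pilotDataOfK T.D T.K)).V, v ∈ (thetaIndex (pilotDataOfK T.D T.K)).Vbad → Type}
    [∀ P l T v h, Monoid (Mv P l T v h)]
    (sig : ∀ (P : NFPoint) (l : ℕ) (T : Cor22.ThetaVolumeDatumAt P l), letI := T.instFieldF; letI := T.instNumberFieldF; letI := T.instAlgebraF; letI := T.instFieldK;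
        letI := T.instNumberFieldK; letI := T.instAlgebraK; letI := T.instFieldFbar; letI := T.instAlgebraFbar;
        letI := T.instAlgebraKFbar; letI := T.instIsElliptic;
      GlobalLGPFrobenioidSignature (thetaIndex (pilotDataOfK T.D T.K)).lstar (thetaIndex (pilotDataOfK T.D T.K)).V (· ∈ (thetaIndex (pilotDataOfK T.D T.K)).Vbad) (Frd P l T) (IsoF P l T) (Ob P l T) (realify P l T)
        (Strip P l T) (IsoS P l T) (Mv P l T))
    (split : ∀ (P : NFPoint) (l : ℕ) (T : Cor22.ThetaVolumeDatumAt P l), SplittingMonoids (Mv P l T))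
    {ObΔ : ∀ (P : NFPoint) (l : ℕ) (T : Cor22.ThetaVolumeDatumAt P l), Type} {N : ∀ (P : NFPoint) (l : ℕ) (T : Cor22.ThetaVolumeDatumAt P l), letI := T.instFieldF; letI := T.instNumberFieldF; letI := T.instAlgebraF; letI := T.instFieldK;
        letI := T.instNumberFieldK; letI := T.instAlgebraK; letI := T.instFieldFbar; letI := T.instAlgebraFbar;
        letI := T.instAlgebraKFbar; letI := T.instIsElliptic;
      ∀ v : (thetaIndex (pilotDataOfK T.D T.K)).V, v ∈ (thetaIndex (pilotDataOfK T.D T.K)).Vbad → Type}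
    [∀ P l T v h, Monoid (N P l T v h)] (qData : ∀ (P : NFPoint) (l : ℕ) (T : Cor22.ThetaVolumeDatumAt P l), QPilotData (ObΔ P l T) (N P l T))
    (qK : ∀ (P : NFPoint) (l : ℕ) (T : Cor22.ThetaVolumeDatumAt P l), letI := T.instFieldF; letI := T.instNumberFieldF; letI := T.instAlgebraF; letI := T.instFieldK;
        letI := T.instNumberFieldK; letI := T.instAlgebraK; letI := T.instFieldFbar; letI := T.instAlgebraFbar;
        letI := T.instAlgebraKFbar; letI := T.instIsElliptic;
      ∀ v : (thetaIndex (pilotDataOfK T.D T.K)).V, v ∈ (thetaIndex (pilotDataOfK T.D T.K)).Vbad → Set ((logShellsDH (pilotDataOfK T.D T.K) (analyticLogv T.K)).StarPacket v))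

/-- `hNumJointZW ⟹ hNumJointZSh` (one antecedent more; pure weakening). [claim: Mochizuki2012, status: disputed] -/
theorem ZetaJunction.hNumJointZSh_of_hNumJointZW
    (hNumJointZW : ∀ (P : NFPoint), P ∈ UP → ∀ (l : ℕ), l.Prime → 5 ≤ l →
      Cor22.AdmitsCore P → Cor22.CondP2 P l → Cor22.CondP5 P l → Cor22.CondP6 P l →
      (((l : ℝ) + 5) / 4 < (Cor22.dmod P : ℝ) ∨
        6 * l * (((l : ℝ) + 5) - 4 * Cor22.dmod P) / (((l : ℝ) + 4) * ((l : ℝ) - 3))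
            * (P.logDiff + (1 - 1 / (l : ℝ)) * Cor22.logCondAvoid P {2, l})
          + 6 * l * ((l : ℝ) + 5) / (((l : ℝ) + 4) * ((l : ℝ) - 3)) * Real.log Real.pi < Cor22.logQAvoid P {2, l}) →
      -- ζ30-CUT (abc-iut-C-cert-1 gen 6): assumed ONLY where the two-layer (μ_l ⊆ K, μ_30 ⊆ F) ramification-sharpened per-image sufficiency
      -- `Cor22.cor312PerImageOf_of_le_degree_thirty` FAILS — on its complement `T.Cor312PerImageOf` is a theorem
      ¬ ((Cor22.dmod P : ℝ) ≤ ((l : ℝ) + 5) / 4 ∧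
          (((l : ℝ) + 1) / 24 - 1 / (2 * l)) * Cor22.logQAvoid P {2, l} ≤
            (((l : ℝ) + 5) / 4 - Cor22.dmod P) * (P.logDiff + (1 - 1 / (l : ℝ)) * Cor22.logCondAvoid P {2, l}
                + max 0 (1 - (P.degree : ℝ) / ((l : ℝ) - 1)) * ((P.degree : ℝ)⁻¹ * Real.log l)
                + max 0 (1 - (P.degree : ℝ) / 2) * ((P.degree : ℝ)⁻¹ *
                    ∑ v ∈ placesOver P.F 3 \ Cor22.badPlacesAvoid P {2, l}, Real.log (Ideal.absNorm v.asIdeal : ℝ))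
                + max 0 (1 - (P.degree : ℝ) / 4) * ((P.degree : ℝ)⁻¹ *
                    ∑ v ∈ placesOver P.F 5 \ Cor22.badPlacesAvoid P {2, l}, Real.log (Ideal.absNorm v.asIdeal : ℝ)))
              + ((l : ℝ) + 5) / 4 * Real.log Real.pi) →
      -- ζ♯w-CUT (abc-iut-C-cert-1 gen 7): assumed, moreover, ONLY where NO rational presentation of `P` (pole dictionary of `j`) passes the
      -- all-levers sufficiency `Cor22.cor312PerImageOf_ratPoint_sharp_wild_unit` (wild different at 2, at the W1/W2 poles over 3, 5; Tate root; μ₃₀, μ_l)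
      ¬ (∃ (q : ℚ) (I : Finset ℕ) (e : ℕ → ℕ) (N' D' : ℕ), P = ratPoint q ∧ q ≠ 0 ∧ q ≠ 1 ∧
          (∀ p ∈ I, p.Prime) ∧ (∀ p ∈ I, e p ≠ 0) ∧ (D' = ∏ p ∈ I, p ^ e p) ∧
          Cor22.jInv q = (N' : ℚ) / (D' : ℚ) ∧ N' ≠ 0 ∧ (∀ p ∈ I, ¬ p ∣ N') ∧
          (((l : ℝ) + 1) / 24 - 1 / (2 * l)) * Cor22.logQAvoid (ratPoint q) {2, l} ≤
            (((l : ℝ) + 5) / 4 - 1) *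
                ((∑ p ∈ I.filter (fun p => p ≠ 2 ∧ p ≠ l),
                    ((if (p = 3 ∨ p = 5) ∧ 2 ∣ e p ∧ ¬ p ∣ e p / 2 then (2 : ℝ)
                      else if (p = 3 ∨ p = 5) ∧ 2 ∣ e p ∧ p ∣ e p / 2 ∧
                        padicValRat p (((Cor22.jInv q)⁻¹ / (p : ℚ) ^ (e p)) ^ (p - 1) - 1) = 1 then 1 + (p : ℝ)⁻¹ else 1)
                      - ((l * Nat.lcm (30 / Nat.gcd 30 (e p)) (if p = 3 then 2 else if p = 5 then 4 else 1) : ℕ) : ℝ)⁻¹)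
                      * Real.log p)
                  + (if 2 ∈ I then (3 : ℝ) / 2 - ((Nat.lcm 2 (30 / Nat.gcd 30 (e 2)) : ℕ) : ℝ)⁻¹ else 1) * Real.log 2
                  + (if 3 ∈ I then 0 else 2⁻¹ * Real.log 3)
                  + (if 5 ∈ I then 0 else (3 / 4 : ℝ) * Real.log 5)
                  + (1 - ((l - 1 : ℕ) : ℝ)⁻¹) * Real.log l)
              + ((l : ℝ) + 5) / 4 * Real.log Real.pi) →
      ∀ (T : Cor22.ThetaVolumeDatumAt P l), letI := T.instFieldF; letI := T.instNumberFieldF; letI := T.instAlgebraF; letI := T.instFieldK;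
        letI := T.instNumberFieldK; letI := T.instAlgebraK; letI := T.instFieldFbar; letI := T.instAlgebraFbar;
        letI := T.instAlgebraKFbar; letI := T.instIsElliptic;
      ¬ (settingPrVolSharp (pilotDataOfK T.D T.K) (logvAnalytic_analyticLogv (F := T.K)) (M P l T) (archPk P l T) (archSub P l T) (Ψ P l T)
          (act P l T) (Mmod P l T) (region P l T) (n P l T) (lat P l T) (sig P l T) (split P l T) (qData P l T)
          (exists_realising_qIdeles_pilotDataOfK T.D).choose
          (exists_realising_thetaIdeles_pilotDataOfK T.D).choose
          (exists_realising_qIdeles_pilotDataOfK T.D).choose_spec.1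
          (exists_realising_qIdeles_pilotDataOfK T.D).choose_spec.2.1).SlotLicence →
      (¬ (Cor312Vol.PilotKummerCompatHull
        (LatticeSituation.ofShells (logShellsDH (pilotDataOfK T.D T.K) (analyticLogv T.K)) (M P l T) (archPk P l T)
          (archSub P l T) (summandPiecesPr (pilotDataOfK T.D T.K) (logvAnalytic_analyticLogv (F := T.K))).Adm
          (summandPiecesPr (pilotDataOfK T.D T.K) (logvAnalytic_analyticLogv (F := T.K))).logvol (Ψ P l T) (act P l T) (Mmod P l T)
          (region P l T) (frobAdm P l T) (frobLogvol P l T) (frobΨ P l T) (frobMmod P l T) (unitImage P l T)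
          (ballImage P l T) (thetaDiv P l T))
        (settingPrVolSharp (pilotDataOfK T.D T.K) (logvAnalytic_analyticLogv (F := T.K)) (M P l T) (archPk P l T) (archSub P l T) (Ψ P l T)
          (act P l T) (Mmod P l T) (region P l T) (n P l T) (lat P l T) (sig P l T) (split P l T) (qData P l T)
          (exists_realising_qIdeles_pilotDataOfK T.D).choose
          (exists_realising_thetaIdeles_pilotDataOfK T.D).choose
          (exists_realising_qIdeles_pilotDataOfK T.D).choose_spec.1
          (exists_realising_qIdeles_pilotDataOfK T.D).choose_spec.2.1)
        (fun _ => Cor312.Setting.qRegion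
        (settingPrVolSharp (pilotDataOfK T.D T.K) (logvAnalytic_analyticLogv (F := T.K)) (M P l T) (archPk P l T) (archSub P l T) (Ψ P l T)
          (act P l T) (Mmod P l T) (region P l T) (n P l T) (lat P l T) (sig P l T) (split P l T) (qData P l T)
          (exists_realising_qIdeles_pilotDataOfK T.D).choose
          (exists_realising_thetaIdeles_pilotDataOfK T.D).choose
          (exists_realising_qIdeles_pilotDataOfK T.D).choose_spec.1
          (exists_realising_qIdeles_pilotDataOfK T.D).choose_spec.2.1)) (qK P l T)) ∨
        ¬ (∃ M : Finset ℕ,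
        (∀ p : ℕ, p.Prime →
          (¬ ∀ V W : HeightOneSpectrum (𝓞 ↥(IntermediateField.adjoin ℚ ({Cor22.jInv P.x} : Set P.F))),
            V ∈ placesOver _ p → W ∈ placesOver _ p →
            (if ord _ V (Cor22.jMod P) < 0 ∧ ((2 : ℕ) : 𝓞 _) ∉ V.asIdeal ∧ ((l : ℕ) : 𝓞 _) ∉ V.asIdeal
              then ((-ord _ V (Cor22.jMod P) : ℤ) : ℝ) * logNorm _ V / (localDegree _ V : ℝ) else 0) =
            (if ord _ W (Cor22.jMod P) < 0 ∧ ((2 : ℕ) : 𝓞 _) ∉ W.asIdeal ∧ ((l : ℕ) : 𝓞 _) ∉ W.asIdeal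
              then ((-ord _ W (Cor22.jMod P) : ℤ) : ℝ) * logNorm _ W / (localDegree _ W : ℝ) else 0)) → p ∈ M) ∧
        ((l : ℝ) + 1) / 24 *
            ∑ p ∈ M, ∑ V : placesOver ↥(IntermediateField.adjoin ℚ ({Cor22.jInv P.x} : Set P.F)) p,
              (if ord _ V.1 (Cor22.jMod P) < 0 ∧ ((2 : ℕ) : 𝓞 _) ∉ V.1.asIdeal ∧ ((l : ℕ) : 𝓞 _) ∉ V.1.asIdeal then
                weight _ V.1 * (((-ord _ V.1 (Cor22.jMod P) : ℤ) : ℝ) * logNorm _ V.1 / (localDegree _ V.1 : ℝ))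
               else 0) ≤
          ((l : ℝ) + 1) / 4 * (4 * ((Cor22.dmod P : ℝ) - 1) / l * (P.logDiff + Cor22.logCondAvoid P {2, l})
            + 20 / 3 * Real.log (((2 ^ 12 * 3 ^ 3 * 5 * Cor22.dmod P : ℕ) : ℝ) * l)
              * max 0 (((Nat.primeCounting (2 ^ 12 * 3 ^ 3 * 5 * Cor22.dmod P * l) : ℝ)
                - (2 * (Cor22.dmod P : ℝ) * (P.logDiff + Cor22.logCondAvoid P {2, l}) + Real.log (2 * 3 * 5 * (l : ℝ)))
                  / Real.log 2))))) →
      T.Cor312PerImageOf) :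
    ∀ (P : NFPoint), P ∈ UP → ∀ (l : ℕ), l.Prime → 5 ≤ l →
      Cor22.AdmitsCore P → Cor22.CondP2 P l → Cor22.CondP5 P l → Cor22.CondP6 P l →
      (((l : ℝ) + 5) / 4 < (Cor22.dmod P : ℝ) ∨
        6 * l * (((l : ℝ) + 5) - 4 * Cor22.dmod P) / (((l : ℝ) + 4) * ((l : ℝ) - 3))
            * (P.logDiff + (1 - 1 / (l : ℝ)) * Cor22.logCondAvoid P {2, l})
          + 6 * l * ((l : ℝ) + 5) / (((l : ℝ) + 4) * ((l : ℝ) - 3)) * Real.log Real.pi < Cor22.logQAvoid P {2, l}) →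
      -- ζ30-CUT (abc-iut-C-cert-1 gen 6): assumed ONLY where the two-layer (μ_l ⊆ K, μ_30 ⊆ F) ramification-sharpened per-image sufficiency
      -- `Cor22.cor312PerImageOf_of_le_degree_thirty` FAILS — on its complement `T.Cor312PerImageOf` is a theorem
      ¬ ((Cor22.dmod P : ℝ) ≤ ((l : ℝ) + 5) / 4 ∧
          (((l : ℝ) + 1) / 24 - 1 / (2 * l)) * Cor22.logQAvoid P {2, l} ≤
            (((l : ℝ) + 5) / 4 - Cor22.dmod P) * (P.logDiff + (1 - 1 / (l : ℝ)) * Cor22.logCondAvoid P {2, l}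
                + max 0 (1 - (P.degree : ℝ) / ((l : ℝ) - 1)) * ((P.degree : ℝ)⁻¹ * Real.log l)
                + max 0 (1 - (P.degree : ℝ) / 2) * ((P.degree : ℝ)⁻¹ *
                    ∑ v ∈ placesOver P.F 3 \ Cor22.badPlacesAvoid P {2, l}, Real.log (Ideal.absNorm v.asIdeal : ℝ))
                + max 0 (1 - (P.degree : ℝ) / 4) * ((P.degree : ℝ)⁻¹ *
                    ∑ v ∈ placesOver P.F 5 \ Cor22.badPlacesAvoid P {2, l}, Real.log (Ideal.absNorm v.asIdeal : ℝ)))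
              + ((l : ℝ) + 5) / 4 * Real.log Real.pi) →
      -- ζ♯w-CUT (abc-iut-C-cert-1 gen 7): assumed, moreover, ONLY where NO rational presentation of `P` (pole dictionary of `j`) passes the
      -- all-levers sufficiency `Cor22.cor312PerImageOf_ratPoint_sharp_wild_unit` (wild different at 2, at the W1/W2 poles over 3, 5; Tate root; μ₃₀, μ_l)
      ¬ (∃ (q : ℚ) (I : Finset ℕ) (e : ℕ → ℕ) (N' D' : ℕ), P = ratPoint q ∧ q ≠ 0 ∧ q ≠ 1 ∧
          (∀ p ∈ I, p.Prime) ∧ (∀ p ∈ I, e p ≠ 0) ∧ (D' = ∏ p ∈ I, p ^ e p) ∧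
          Cor22.jInv q = (N' : ℚ) / (D' : ℚ) ∧ N' ≠ 0 ∧ (∀ p ∈ I, ¬ p ∣ N') ∧
          (((l : ℝ) + 1) / 24 - 1 / (2 * l)) * Cor22.logQAvoid (ratPoint q) {2, l} ≤
            (((l : ℝ) + 5) / 4 - 1) *
                ((∑ p ∈ I.filter (fun p => p ≠ 2 ∧ p ≠ l),
                    ((if (p = 3 ∨ p = 5) ∧ 2 ∣ e p ∧ ¬ p ∣ e p / 2 then (2 : ℝ)
                      else if (p = 3 ∨ p = 5) ∧ 2 ∣ e p ∧ p ∣ e p / 2 ∧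
                        padicValRat p (((Cor22.jInv q)⁻¹ / (p : ℚ) ^ (e p)) ^ (p - 1) - 1) = 1 then 1 + (p : ℝ)⁻¹ else 1)
                      - ((l * Nat.lcm (30 / Nat.gcd 30 (e p)) (if p = 3 then 2 else if p = 5 then 4 else 1) : ℕ) : ℝ)⁻¹)
                      * Real.log p)
                  + (if 2 ∈ I then (3 : ℝ) / 2 - ((Nat.lcm 2 (30 / Nat.gcd 30 (e 2)) : ℕ) : ℝ)⁻¹ else 1) * Real.log 2
                  + (if 3 ∈ I then 0 else 2⁻¹ * Real.log 3)
                  + (if 5 ∈ I then 0 else (3 / 4 : ℝ) * Real.log 5)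
                  + (1 - ((l - 1 : ℕ) : ℝ)⁻¹) * Real.log l)
              + ((l : ℝ) + 5) / 4 * Real.log Real.pi) →
      -- ζ-SHELL-CUT (abc-iut-C-cert-1 gen 7): assumed, moreover, ONLY where NO rational presentation of `P` with shell poles `Psh ⊆ I` (p ≠ 2, l;
      -- l ∤ p − 1) and exponents `a` passes abc-iut-c312-d1's log-shell sufficiency `Cor22.cor312PerImageOf_ratPoint_shell` (wild log-shell term)
      ¬ (∃ (q : ℚ) (I : Finset ℕ) (e : ℕ → ℕ) (N' D' : ℕ) (Psh : Finset ℕ) (a : ℕ → ℕ), P = ratPoint q ∧ q ≠ 0 ∧ q ≠ 1 ∧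
          (∀ p ∈ I, p.Prime) ∧ (∀ p ∈ I, e p ≠ 0) ∧ (D' = ∏ p ∈ I, p ^ e p) ∧
          Cor22.jInv q = (N' : ℚ) / (D' : ℚ) ∧ N' ≠ 0 ∧ (∀ p ∈ I, ¬ p ∣ N') ∧
          Psh ⊆ I ∧ (∀ p ∈ Psh, p ≠ 2 ∧ p ≠ l ∧ ¬ l ∣ p - 1) ∧
          (((l : ℝ) + 1) / 24 - 1 / (2 * l)) * Cor22.logQAvoid (ratPoint q) {2, l} ≤
            (((l : ℝ) + 5) / 4 - 1) *
                ((∑ p ∈ I.filter (fun p => p ≠ 2 ∧ p ≠ l),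
                    (1 - ((l * Nat.lcm (30 / Nat.gcd 30 (e p)) (if p = 3 then 2 else if p = 5 then 4 else 1) : ℕ) : ℝ)⁻¹)
                      * Real.log p)
                  + 2⁻¹ * Real.log 2
                  + (if 3 ∈ I then 0 else 2⁻¹ * Real.log 3)
                  + (if 5 ∈ I then 0 else (3 / 4 : ℝ) * Real.log 5)
                  + (1 - ((l - 1 : ℕ) : ℝ)⁻¹) * Real.log l)
              + ((l : ℝ) + 5) / 4 * ∑ p ∈ Psh,
                  (((a p : ℕ) : ℝ) - (p : ℝ) ^ (a p) /
                      ((l * Nat.lcm (30 / Nat.gcd 30 (e p)) (if p = 3 then 2 else if p = 5 then 4 else 1) : ℕ) : ℝ)) * Real.log p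
              + ((l : ℝ) + 5) / 4 * Real.log Real.pi) →
      ∀ (T : Cor22.ThetaVolumeDatumAt P l), letI := T.instFieldF; letI := T.instNumberFieldF; letI := T.instAlgebraF; letI := T.instFieldK;
        letI := T.instNumberFieldK; letI := T.instAlgebraK; letI := T.instFieldFbar; letI := T.instAlgebraFbar;
        letI := T.instAlgebraKFbar; letI := T.instIsElliptic;
      ¬ (settingPrVolSharp (pilotDataOfK T.D T.K) (logvAnalytic_analyticLogv (F := T.K)) (M P l T) (archPk P l T) (archSub P l T) (Ψ P l T)
          (act P l T) (Mmod P l T) (region P l T) (n P l T) (lat P l T) (sig P l T) (split P l T) (qData P l T)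
          (exists_realising_qIdeles_pilotDataOfK T.D).choose
          (exists_realising_thetaIdeles_pilotDataOfK T.D).choose
          (exists_realising_qIdeles_pilotDataOfK T.D).choose_spec.1
          (exists_realising_qIdeles_pilotDataOfK T.D).choose_spec.2.1).SlotLicence →
      (¬ (Cor312Vol.PilotKummerCompatHull
        (LatticeSituation.ofShells (logShellsDH (pilotDataOfK T.D T.K) (analyticLogv T.K)) (M P l T) (archPk P l T)
          (archSub P l T) (summandPiecesPr (pilotDataOfK T.D T.K) (logvAnalytic_analyticLogv (F := T.K))).Adm
          (summandPiecesPr (pilotDataOfK T.D T.K) (logvAnalytic_analyticLogv (F := T.K))).logvol (Ψ P l T) (act P l T) (Mmod P l T)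
          (region P l T) (frobAdm P l T) (frobLogvol P l T) (frobΨ P l T) (frobMmod P l T) (unitImage P l T)
          (ballImage P l T) (thetaDiv P l T))
        (settingPrVolSharp (pilotDataOfK T.D T.K) (logvAnalytic_analyticLogv (F := T.K)) (M P l T) (archPk P l T) (archSub P l T) (Ψ P l T)
          (act P l T) (Mmod P l T) (region P l T) (n P l T) (lat P l T) (sig P l T) (split P l T) (qData P l T)
          (exists_realising_qIdeles_pilotDataOfK T.D).choose
          (exists_realising_thetaIdeles_pilotDataOfK T.D).choose
          (exists_realising_qIdeles_pilotDataOfK T.D).choose_spec.1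
          (exists_realising_qIdeles_pilotDataOfK T.D).choose_spec.2.1)
        (fun _ => Cor312.Setting.qRegion
        (settingPrVolSharp (pilotDataOfK T.D T.K) (logvAnalytic_analyticLogv (F := T.K)) (M P l T) (archPk P l T) (archSub P l T) (Ψ P l T)
          (act P l T) (Mmod P l T) (region P l T) (n P l T) (lat P l T) (sig P l T) (split P l T) (qData P l T)
          (exists_realising_qIdeles_pilotDataOfK T.D).choose
          (exists_realising_thetaIdeles_pilotDataOfK T.D).choose
          (exists_realising_qIdeles_pilotDataOfK T.D).choose_spec.1
          (exists_realising_qIdeles_pilotDataOfK T.D).choose_spec.2.1)) (qK P l T)) ∨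
        ¬ (∃ M : Finset ℕ,
        (∀ p : ℕ, p.Prime →
          (¬ ∀ V W : HeightOneSpectrum (𝓞 ↥(IntermediateField.adjoin ℚ ({Cor22.jInv P.x} : Set P.F))),
            V ∈ placesOver _ p → W ∈ placesOver _ p →
            (if ord _ V (Cor22.jMod P) < 0 ∧ ((2 : ℕ) : 𝓞 _) ∉ V.asIdeal ∧ ((l : ℕ) : 𝓞 _) ∉ V.asIdeal
              then ((-ord _ V (Cor22.jMod P) : ℤ) : ℝ) * logNorm _ V / (localDegree _ V : ℝ) else 0) =
            (if ord _ W (Cor22.jMod P) < 0 ∧ ((2 : ℕ) : 𝓞 _) ∉ W.asIdeal ∧ ((l : ℕ) : 𝓞 _) ∉ W.asIdeal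
              then ((-ord _ W (Cor22.jMod P) : ℤ) : ℝ) * logNorm _ W / (localDegree _ W : ℝ) else 0)) → p ∈ M) ∧
        ((l : ℝ) + 1) / 24 *
            ∑ p ∈ M, ∑ V : placesOver ↥(IntermediateField.adjoin ℚ ({Cor22.jInv P.x} : Set P.F)) p,
              (if ord _ V.1 (Cor22.jMod P) < 0 ∧ ((2 : ℕ) : 𝓞 _) ∉ V.1.asIdeal ∧ ((l : ℕ) : 𝓞 _) ∉ V.1.asIdeal then
                weight _ V.1 * (((-ord _ V.1 (Cor22.jMod P) : ℤ) : ℝ) * logNorm _ V.1 / (localDegree _ V.1 : ℝ))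
               else 0) ≤
          ((l : ℝ) + 1) / 4 * (4 * ((Cor22.dmod P : ℝ) - 1) / l * (P.logDiff + Cor22.logCondAvoid P {2, l})
            + 20 / 3 * Real.log (((2 ^ 12 * 3 ^ 3 * 5 * Cor22.dmod P : ℕ) : ℝ) * l)
              * max 0 (((Nat.primeCounting (2 ^ 12 * 3 ^ 3 * 5 * Cor22.dmod P * l) : ℝ)
                - (2 * (Cor22.dmod P : ℝ) * (P.logDiff + Cor22.logCondAvoid P {2, l}) + Real.log (2 * 3 * 5 * (l : ℝ)))
                  / Real.log 2))))) →
      T.Cor312PerImageOf :=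
  fun P hP l hl h5 hc h2 h5' h6 hbad hz hw _ =>
    hNumJointZW P hP l hl h5 hc h2 h5' h6 hbad hz hw

end Summit.ABC.IUTFork.Conditional

end
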